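import Literature.NumberTheory.BeurlingPrimes.ZetaPoleObstruction
import Literature.NumberTheory.BeurlingPrimes.ErrorExponents
import Literature.NumberTheory.BeurlingPrimes.WellBehavedSystems
import HarnessLib

/-!
# BDR 2023, Corollary 3.3 from Theorem 3.2

Topic `Literature/NumberTheory/BeurlingPrimes`. Everything in this file is PROVED: the named fact
`BrouckeDebruyneRevesz2023_cor33` ("Let `1/2 ≤ β ≤ α < 1`. Then there exists an `[α,β]`-Beurling system") of
`WellBehavedSystems.lean` follows from `BrouckeDebruyneRevesz2023_thm32`, as printed: "This immediately follows
from the theorem upon selecting `ℛ = {α}`, `𝒮 = {β}` if `α > β`, and `ℛ = ∅`, `𝒮 = {β}` if `α = β`. In the case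
`β = 1/2`, the second assertion of the theorem only yields `N_𝒫(x) = ax + O{x^{1/2} exp(c(log x)^{2/3})}`, but no
oscillation result. However, with the presence of a pole of `ζ_𝒫(s)` at `s = β = 1/2`, it is clear … that
`N_𝒫(x) − ax ≪ x^{1/2−ε}` cannot hold for any `ε > 0`" (`ZetaPoleObstruction.lean`). Here `δ = β/2`.

* `primeClauses_of_mainTerm` — `ψ_P(x) − x = b x^α + O(x^γ)` (`b ≠ 0`, `γ < α`) gives exact prime exponent `α`;
* `intClauses_of_thm32_data` — the integer clauses of an `[·, β]`-system from the `N_𝒫`- and `ζ_𝒫`-clauses of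
  Theorem 3.2 with `𝒮 = {β}` (`β > 1/2`: main term `b_β x^β`; `β = 1/2`: the pole);
* `BrouckeDebruyneRevesz2023_cor33_of_thm32`.

## References
* [BrouckeDebruyneRevesz2023] F. Broucke, G. Debruyne, Sz. Gy. Révész, *Some examples of well-behaved Beurling
  number systems*, arXiv:2309.01567, Corollary 3.3 and its proof.
-/

noncomputable section

open Filter Set
open scoped Topology

namespace Literature.NumberTheory.BeurlingPrimes

open Literature.Barriers.RiemannHypothesis

/-- **Exact prime exponent from a main term**: if `|ψ_P(x) − x − b x^α| ≤ K x^γ` on `[1, ∞)` with `b ≠ 0`,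
`0 ≤ α`, `γ < α`, then `ψ_P(x) = x + O_ε(x^{α+ε})` for every `ε > 0` and for no `ε < 0`.
[cite: BrouckeDebruyneRevesz2023, proof of Corollary 3.3] -/
theorem _root_.Literature.Barriers.RiemannHypothesis.BeurlingPrimes.primeClauses_of_mainTerm {P : BeurlingPrimes}
    {b α γ K : ℝ} (hb : b ≠ 0) (hα : 0 ≤ α) (hγ : γ < α)
    (h : ∀ x : ℝ, 1 ≤ x → |P.chebyshevPsi x - x - b * x ^ α| ≤ K * x ^ γ) :
    (∀ ε : ℝ, 0 < ε → P.PrimeErrorLE (α + ε)) ∧ ∀ ε : ℝ, 0 < ε → ¬ P.PrimeErrorLE (α - ε) := by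
  refine ⟨fun ε hε ↦ ?_, fun ε hε ↦ P.not_primeErrorLE_of_mainTerm hb hγ h hε⟩
  refine BeurlingPrimes.PrimeErrorLE.of_le P ?_ (show α ≤ α + ε by linarith)
  refine P.primeErrorLE_of_forall_ge hα (X := 1) (C := |b| + |K|) fun x hx ↦ ?_
  have h1 := h x hx
  have hxα : 0 ≤ x ^ α := Real.rpow_nonneg (by linarith) _
  have h2 : x ^ γ ≤ x ^ α := Real.rpow_le_rpow_of_exponent_le hx hγ.le
  have h3 : |b * x ^ α| = |b| * x ^ α := by rw [abs_mul, abs_of_nonneg hxα]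
  have h4 : |P.chebyshevPsi x - x| ≤ |b| * x ^ α + K * x ^ γ := by
    have := abs_sub_abs_le_abs_sub (P.chebyshevPsi x - x) (b * x ^ α)
    linarith
  have h5 : K * x ^ γ ≤ |K| * x ^ α :=
    (mul_le_mul_of_nonneg_right (le_abs_self K) (Real.rpow_nonneg (by linarith) _)).trans
      (mul_le_mul_of_nonneg_left h2 (abs_nonneg K))
  calc |P.chebyshevPsi x - x| ≤ |b| * x ^ α + |K| * x ^ α := by linarith
    _ = (|b| + |K|) * x ^ α := by ring

/-- **The integer clauses from the data of Theorem 3.2 with `𝒮 = {β}`** (`1/2 ≤ β`, `0 < δ < 1/2`, `1/2 ∉ ℛ`):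
`N_𝒫(x) = ax + O_ε(x^{β+ε})` for every `ε > 0`, and for no `ε < 0` — from the main term `b_β x^β` if `β > 1/2`,
from the pole of `ζ_𝒫` at `1/2` if `β = 1/2`. [cite: BrouckeDebruyneRevesz2023, proof of Corollary 3.3] -/
theorem _root_.Literature.Barriers.RiemannHypothesis.BeurlingPrimes.intClauses_of_thm32_data {P : BeurlingPrimes}
    {β δ a c C₂ : ℝ} {b : ℝ → ℝ} {R : Finset ℝ} {M : ℕ} {Z : ℂ → ℂ}
    (hβ : 1 / 2 ≤ β) (hδ0 : 0 < δ) (hδ : δ < 1 / 2) (hR : ∀ ρ ∈ R, ρ ≠ 1 / 2) (hc : 0 < c)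
    (hb : ∀ ω ∈ ({β} : Finset ℝ), 1 / 2 < ω → b ω ≠ 0)
    (hN : ∀ x : ℝ, 2 ≤ x →
      |(P.intCount x : ℝ) - (a * x + ∑ ω ∈ ({β} : Finset ℝ) with 1 / 2 < ω, b ω * x ^ ω)|
        ≤ C₂ * (x ^ (1 / 2 : ℝ) * Real.exp (c * Real.log x ^ (2 / 3 : ℝ))))
    (hZd : DifferentiableOn ℂ Z {s : ℂ | 0 < s.re})
    (hζ : ∀ s : ℂ, 1 < s.re → P.zeta s =
      s / (s - 1) * (∏ ω ∈ ({β} : Finset ℝ), s / (s - ω)) * (∏ ρ ∈ R, (s - ρ) / s) * (s / (s - δ)) ^ M *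
        Complex.exp (Z s)) :
    (∀ ε : ℝ, 0 < ε → P.IntErrorLE a (β + ε)) ∧ ∀ ε : ℝ, 0 < ε → ¬ P.IntErrorLE a (β - ε) := by
  rcases hβ.eq_or_lt with hhalf | hgt
  · -- `β = 1/2`: no main term; the pole at `1/2`
    subst hhalf
    have hN' : ∀ x : ℝ, 2 ≤ x → |(P.intCount x : ℝ) - a * x| ≤
        |C₂| * (x ^ (1 / 2 : ℝ) * Real.exp (c * Real.log x ^ (2 / 3 : ℝ))) := by
      intro x hx
      have h := hN x hx
      have he : ({1 / 2} : Finset ℝ).filter (fun ω ↦ 1 / 2 < ω) = ∅ := by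
        ext ω
        simp only [Finset.mem_filter, Finset.mem_singleton, Finset.notMem_empty, iff_false, not_and, not_lt]
        exact fun h ↦ h.le
      rw [he, Finset.sum_empty, add_zero] at h
      exact h.trans (mul_le_mul_of_nonneg_right (le_abs_self _) (by positivity))
    refine ⟨fun ε hε ↦ ?_, fun ε hε ↦ ?_⟩
    · obtain ⟨D, hD, hDle⟩ := sqrt_mul_exp_log_rpow_le hc hε
      refine P.intErrorLE_of_forall_ge (by linarith) (X := 2) (C := |C₂| * D) fun x hx ↦ ?_
      calc |(P.intCount x : ℝ) - a * x| ≤ |C₂| * (x ^ (1 / 2 : ℝ) * Real.exp (c * Real.log x ^ (2 / 3 : ℝ))) :=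
            hN' x hx
        _ ≤ |C₂| * (D * x ^ (1 / 2 + ε)) := mul_le_mul_of_nonneg_left (hDle x (by linarith)) (abs_nonneg _)
        _ = |C₂| * D * x ^ (1 / 2 + ε) := by ring
    · have hζ' : ∀ s : ℂ, 1 < s.re → P.zeta s = s / (s - 1) * (s / (s - (1 / 2 : ℝ))) *
          (∏ ρ ∈ R, (s - ρ) / s) * (s / (s - δ)) ^ M * Complex.exp (Z s) := by
        intro s hs
        rw [hζ s hs, Finset.prod_singleton]
      exact BeurlingPrimes.not_intErrorLE_of_zeta_pole hδ0 hδ hR hZd hζ' hε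
  · -- `β > 1/2`: main term `b_β x^β`
    have hbβ : b β ≠ 0 := hb β (Finset.mem_singleton_self β) hgt
    have hN' : ∀ x : ℝ, 2 ≤ x → |(P.intCount x : ℝ) - a * x - b β * x ^ β| ≤
        |C₂| * (x ^ (1 / 2 : ℝ) * Real.exp (c * Real.log x ^ (2 / 3 : ℝ))) := by
      intro x hx
      have h := hN x hx
      have he : ({β} : Finset ℝ).filter (fun ω ↦ 1 / 2 < ω) = {β} := by
        ext ω; simp only [Finset.mem_filter, Finset.mem_singleton]
        exact ⟨fun h ↦ h.1, fun h ↦ ⟨h, h ▸ hgt⟩⟩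
      rw [he, Finset.sum_singleton, ← sub_sub] at h
      exact h.trans (mul_le_mul_of_nonneg_right (le_abs_self _) (by positivity))
    refine ⟨fun ε hε ↦ ?_, fun ε hε ↦ ?_⟩
    · obtain ⟨D, hD, hDle⟩ := sqrt_mul_exp_log_rpow_le hc hε
      refine P.intErrorLE_of_forall_ge (by linarith) (X := 2) (C := |b β| + |C₂| * D) fun x hx ↦ ?_
      have hx1 : 1 ≤ x := by linarith
      have h1 := hN' x hx
      have h2 : x ^ (1 / 2 + ε) ≤ x ^ (β + ε) := Real.rpow_le_rpow_of_exponent_le hx1 (by linarith)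
      have h3 : x ^ β ≤ x ^ (β + ε) := Real.rpow_le_rpow_of_exponent_le hx1 (by linarith)
      have h4 : |b β * x ^ β| ≤ |b β| * x ^ (β + ε) := by
        rw [abs_mul, abs_of_nonneg (Real.rpow_nonneg (by linarith) _)]
        exact mul_le_mul_of_nonneg_left h3 (abs_nonneg _)
      have h5 : |C₂| * (x ^ (1 / 2 : ℝ) * Real.exp (c * Real.log x ^ (2 / 3 : ℝ))) ≤ |C₂| * D * x ^ (β + ε) :=
        calc _ ≤ |C₂| * (D * x ^ (1 / 2 + ε)) := mul_le_mul_of_nonneg_left (hDle x hx1) (abs_nonneg _)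
          _ ≤ |C₂| * (D * x ^ (β + ε)) := mul_le_mul_of_nonneg_left (mul_le_mul_of_nonneg_left h2 hD.le) (abs_nonneg _)
          _ = |C₂| * D * x ^ (β + ε) := by ring
      have h6 : |(P.intCount x : ℝ) - a * x| ≤ |b β * x ^ β| + |(P.intCount x : ℝ) - a * x - b β * x ^ β| := by
        have := abs_add_le (b β * x ^ β) ((P.intCount x : ℝ) - a * x - b β * x ^ β)
        rwa [add_sub_cancel] at this
      calc |(P.intCount x : ℝ) - a * x| ≤ |b β| * x ^ (β + ε) + |C₂| * D * x ^ (β + ε) := by linarith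
        _ = (|b β| + |C₂| * D) * x ^ (β + ε) := by ring
    · set ε₀ : ℝ := (β - 1 / 2) / 2 with hε₀
      have hε₀0 : 0 < ε₀ := by rw [hε₀]; linarith
      obtain ⟨D, hD, hDle⟩ := sqrt_mul_exp_log_rpow_le hc hε₀0
      have hE : ∀ x : ℝ, 2 ≤ x → |(P.intCount x : ℝ) - a * x - b β * x ^ β| ≤ |C₂| * D * x ^ (1 / 2 + ε₀) := by
        intro x hx
        calc _ ≤ |C₂| * (x ^ (1 / 2 : ℝ) * Real.exp (c * Real.log x ^ (2 / 3 : ℝ))) := hN' x hx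
          _ ≤ |C₂| * (D * x ^ (1 / 2 + ε₀)) := mul_le_mul_of_nonneg_left (hDle x (by linarith)) (abs_nonneg _)
          _ = |C₂| * D * x ^ (1 / 2 + ε₀) := by ring
      exact P.not_intErrorLE_of_mainTerm hbβ (show 1 / 2 + ε₀ < β by rw [hε₀]; linarith) hE hε

/-- **BDR 2023, Corollary 3.3** from Theorem 3.2 (`ℛ = {α}` or `∅`, `𝒮 = {β}`, `δ = β/2`).
[cite: BrouckeDebruyneRevesz2023, Corollary 3.3] -/
theorem BrouckeDebruyneRevesz2023_cor33_of_thm32 (h32 : BrouckeDebruyneRevesz2023_thm32) :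
    BrouckeDebruyneRevesz2023_cor33 := by
  intro α β hβ hβα hα1
  have hβ1 : β < 1 := lt_of_le_of_lt hβα hα1
  have hβ0 : 0 < β := by linarith
  have hδ0 : 0 < β / 2 := by linarith
  have hδ : β / 2 < 1 / 2 := by linarith
  have hS : ∀ ω ∈ ({β} : Finset ℝ), 0 < ω ∧ ω < 1 := fun ω hω ↦ by
    rw [Finset.mem_singleton] at hω; rw [hω]; exact ⟨hβ0, hβ1⟩
  rcases hβα.eq_or_lt with heq | hlt
  · -- `α = β`: `ℛ = ∅`
    subst heq
    obtain ⟨P, ⟨C, hψ⟩, ⟨a, c, C₂, b, ha, hc, hb, hN⟩, ⟨M, Z, K, hZd, -, hζ⟩⟩ :=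
      h32 ∅ {β} (β / 2) (Finset.disjoint_empty_left _) (by simp) hS hδ0 hδ
    have hψ' : ∀ x : ℝ, 1 ≤ x → |P.chebyshevPsi x - x - (1 / β) * x ^ β| ≤ C * x ^ (β / 2) := by
      intro x hx
      have h := hψ x hx
      rw [Finset.sum_empty, Finset.sum_singleton, sub_zero] at h
      have e : P.chebyshevPsi x - x - 1 / β * x ^ β = P.chebyshevPsi x - (x + x ^ β / β) := by ring
      rwa [e]
    obtain ⟨hpu, hpl⟩ := BeurlingPrimes.primeClauses_of_mainTerm (one_div_ne_zero hβ0.ne') hβ0.le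
      (show β / 2 < β by linarith) hψ'
    obtain ⟨hiu, hil⟩ := BeurlingPrimes.intClauses_of_thm32_data hβ hδ0 hδ (R := ∅) (by simp) hc hb hN hZd hζ
    exact ⟨P, hβ0.le, hβ1, hβ0.le, hβ1, a, ha, hiu, hil, hpu, hpl⟩
  · -- `α > β`: `ℛ = {α}`
    have hα0 : 0 < α := by linarith
    obtain ⟨P, ⟨C, hψ⟩, ⟨a, c, C₂, b, ha, hc, hb, hN⟩, ⟨M, Z, K, hZd, -, hζ⟩⟩ :=
      h32 {α} {β} (β / 2) (Finset.disjoint_singleton.mpr (ne_of_gt hlt)) (fun ρ hρ ↦ by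
        rw [Finset.mem_singleton] at hρ; rw [hρ]; exact ⟨hα0, hα1⟩) hS hδ0 hδ
    have hψ' : ∀ x : ℝ, 1 ≤ x → |P.chebyshevPsi x - x - (-1 / α) * x ^ α| ≤ (1 / β + |C|) * x ^ β := by
      intro x hx
      have h := hψ x hx
      rw [Finset.sum_singleton, Finset.sum_singleton] at h
      have hxβ : 0 ≤ x ^ β := Real.rpow_nonneg (by linarith) _
      have h2 : x ^ (β / 2) ≤ x ^ β := Real.rpow_le_rpow_of_exponent_le hx (by linarith)
      have e : P.chebyshevPsi x - x - (-1 / α) * x ^ α = (P.chebyshevPsi x - (x + x ^ β / β - x ^ α / α)) + x ^ β / β := by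
        ring
      rw [e]
      have h3 : |x ^ β / β| = 1 / β * x ^ β := by rw [abs_div, abs_of_nonneg hxβ, abs_of_pos hβ0]; ring
      have h4 : C * x ^ (β / 2) ≤ |C| * x ^ β :=
        (mul_le_mul_of_nonneg_right (le_abs_self C) (Real.rpow_nonneg (by linarith) _)).trans
          (mul_le_mul_of_nonneg_left h2 (abs_nonneg C))
      calc _ ≤ |P.chebyshevPsi x - (x + x ^ β / β - x ^ α / α)| + |x ^ β / β| := abs_add_le _ _
        _ ≤ |C| * x ^ β + 1 / β * x ^ β := by linarith
        _ = (1 / β + |C|) * x ^ β := by ring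
    obtain ⟨hpu, hpl⟩ := BeurlingPrimes.primeClauses_of_mainTerm (b := -1 / α)
      (div_ne_zero (by norm_num) hα0.ne') hα0.le hlt hψ'
    obtain ⟨hiu, hil⟩ := BeurlingPrimes.intClauses_of_thm32_data hβ hδ0 hδ (R := {α}) (fun ρ hρ ↦ by
      rw [Finset.mem_singleton] at hρ; rw [hρ]; exact ne_of_gt (lt_of_le_of_lt hβ hlt)) hc hb hN hZd hζ
    exact ⟨P, hα0.le, hα1, hβ0.le, hβ1, a, ha, hiu, hil, hpu, hpl⟩

end Literature.NumberTheory.BeurlingPrimes
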